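import Literature.AlgebraicGeometry.Resolution.ExceptionalDivisorChartPolynomial
import Literature.AlgebraicGeometry.Motives.MorphismsToProjectiveSpaceIso
import Literature.AlgebraicGeometry.Motives.VarietiesProjectiveSpaceProofs
import HarnessLib

/-!
# The exceptional divisor of the blow-up along a quasi-regular centre is the projective space over the centre (affine base)

Topic: `Literature/AlgebraicGeometry/Resolution`. Theorem-only file. Hartshorne, *Algebraic Geometry*,
II Thm. 8.24 (b): for the blowing-up `π : X̃ → X` of a nonsingular variety along a nonsingular closed
subvariety `Y` with ideal `𝓘`, the exceptional divisor `Y' = π⁻¹(Y)` "together with the induced projection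
map `π : Y' → Y`, is isomorphic to `ℙ(𝓘/𝓘²)`"; Liu, *Algebraic Geometry and Arithmetic Curves*,
Thm. 8.1.19 (b): for a regular closed subscheme of a regular locally Noetherian scheme "the scheme
`E := π⁻¹(Y)` is a projective bundle `ℙ(C_{Y/X})` of rank `codim(Y, X) − 1` over `Y`". We PROVE the
affine form behind both: let `M` be an affine scheme, `i₀ : B ↪ M` a closed immersion whose ideal
`𝓘(M) = (x₀, …, xₙ)` is generated by a **quasi-regular** sequence of `Γ(M, 𝒪)` (the local shape of a
regular centre in a regular scheme, `RegularCentreLocal.lean`), and `β : X' → M` any blowing up along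
`𝓘 = ker i₀` (universal property). Then the exceptional divisor `E = X' ×_M B`, with its projection
`q = pr₂ : E → B`, **is isomorphic over `B = Spec Γ(B, 𝒪)` to the projective space
`ℙⁿ_{Γ(B, 𝒪)} = Proj Γ(B, 𝒪)[T₀, …, Tₙ]`** (`exists_iso_pullback_proj_of_isQuasiRegular`).

Proof: the principal charts `X'[M, x_j]` and the ratios `T_{jl} = β^*x_l/β^*x_j` (`BlowupChartRatios`,
`ExceptionalDivisorChartSections`) pull back to generating-sections data on `E` (the tree's
`GeneratingSections`, Hartshorne II 7.1), giving `E → ℙⁿ_{Γ(B,𝒪)}`; on the chart `E_{x_j}` the ring map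
`Γ(B,𝒪)[T_l/T_j] → Γ(E, E_{x_j}) ≅ (A/𝓘)[T_l : l ≠ j]` (`ExceptionalDivisorChartPolynomial`) is the
identity on generators, hence bijective, so the morphism is an isomorphism (`GeneratingSections.isIso_toProj`,
Hartshorne II 7.2).

## References

* [Hartshorne1977] R. Hartshorne, Algebraic Geometry (1977), II Thm. 8.24 (b), II Thm. 7.1, Prop. 7.2.
* [Liu2002] Q. Liu, Algebraic Geometry and Arithmetic Curves (2002), Thm. 8.1.19 (b).
* [StacksProject] The Stacks Project, Tag 0804, Tag 0BIQ.
-/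

noncomputable section

open CategoryTheory CategoryTheory.Limits AlgebraicGeometry TopologicalSpace Opposite
open HomogeneousLocalization
open Literature.AlgebraicGeometry.Motives Literature.AlgebraicGeometry.Motives.Segre

attribute [local instance] MvPolynomial.gradedAlgebra ProjBaseChange.algebraBase

namespace Literature.AlgebraicGeometry.Resolution

universe u

variable {X' M B : Scheme.{u}} [IsAffine M] {β : X' ⟶ M} {i₀ : B ⟶ M} [IsClosedImmersion i₀]

/-- In `(R[T₀,…,Tₙ]_{T_j})₀`, the generator `x_{j.succAbove m}/x_j` of the chart algebra is the fraction
`frac` of the Segre file (same numerator and denominator). [folklore] -/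
theorem frac_succAbove_eq_chartGen (R : Type u) [CommRing R] {n : ℕ} (j : Fin (n + 1)) (m : Fin n) :
    frac R j (j.succAbove m) = ProjectiveSpace.chartGen R j m := by
  apply HomogeneousLocalization.val_injective
  rw [val_frac, ProjectiveSpace.val_chartGen, pow_one]

/-- The `R`-structure map of `(R[T]_{T_j})₀` is the Segre file's `cst` (both are `R → R[T]₀ → (R[T]_{T_j})₀`). [folklore] -/
theorem algebraMap_away_eq_cst (R : Type u) [CommRing R] {n : ℕ} (j : Fin (n + 1)) (c : R) :
    algebraMap R (Away (grading (Fin (n + 1)) R) (MvPolynomial.X j)) c = cst R (MvPolynomial.X j) c := rfl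

/-- **The exceptional divisor of the blowing up of an affine scheme along a closed subscheme cut out by a
quasi-regular sequence is the projective space over that subscheme** (Hartshorne II Thm. 8.24 (b) /
Liu Thm. 8.1.19 (b), affine form): for `M` affine, `i₀ : B ↪ M` a closed immersion with
`(ker i₀)(M) = (x₀, …, xₙ)`, `x` quasi-regular in `Γ(M, 𝒪)`, and `β : X' → M` a blowing up along `ker i₀`,
there is an isomorphism `E = X' ×_M B ≅ ℙⁿ_{Γ(B, 𝒪)}` over `Spec Γ(B, 𝒪)` (compatible with
`q = pr₂ : E → B → Spec Γ(B, 𝒪)`). [cite: Hartshorne1977, II Thm. 8.24 (b)] [cite: Liu2002, Thm. 8.1.19 (b)] -/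
theorem exists_iso_pullback_proj_of_isQuasiRegular (hβ : IsBlowup β i₀.ker) {n : ℕ}
    (x : Fin (n + 1) → Γ(M, ⊤))
    (hgen : Ideal.span (Set.range x) = i₀.ker.ideal ⟨⊤, isAffineOpen_top M⟩) (hqr : IsQuasiRegular x) :
    ∃ φ : pullback β i₀ ≅ Proj (grading (Fin (n + 1)) Γ(B, ⊤)),
      φ.hom ≫ toSpec (Fin (n + 1)) Γ(B, ⊤) = pullback.snd β i₀ ≫ B.toSpecΓ := by
  classical
  -- notation
  let Wt : M.affineOpens := ⟨⊤, isAffineOpen_top M⟩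
  have hx : ∀ l, x l ∈ i₀.ker.ideal Wt := fun l ↦ hgen ▸ Ideal.subset_span ⟨l, rfl⟩
  -- the ratios `T j l = β^*x_l / β^*x_j` on the charts `X'[M, x_j]`
  choose T hT using fun j l ↦ hβ.exists_chartRatio Wt (u := x j) (v := x l) (hx j) (hx l)
  -- the generating-sections data on `E`
  let D : GeneratingSections (Fin (n + 1)) (pullback β i₀) :=
    { U := fun j ↦ pullback.fst β i₀ ⁻¹ᵁ blowupChart β i₀.ker Wt (x j)
      iSup_U := (iSup_preimage_fst_blowupChart hβ Wt x hgen).trans rfl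
      ratio := fun j l ↦ (pullback.fst β i₀).app (blowupChart β i₀.ker Wt (x j)) (T j l)
      ratio_self := fun j ↦ by rw [hβ.chartRatio_self Wt (hx j) (hT j j), map_one]
      basicOpen_ratio := fun j l ↦ basicOpen_fst_app_chartRatio hβ Wt (hx j) (hx l) (hT j l)
      ratio_mul_ratio := fun j l m ↦
        fst_app_chartRatio_mul hβ Wt (hx j) (hx l) (hT j l) (hT l m) (hT j m) }
  let f : pullback β i₀ ⟶ Spec (.of Γ(B, ⊤)) := pullback.snd β i₀ ≫ B.toSpecΓ
  have hU : ∀ j, IsAffineOpen (D.U j) := fun j ↦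
    (hβ.isAffineOpen_blowupChart (hx j)).preimage (pullback.fst β i₀)
  -- the centre: `Γ(M, 𝒪) / (x) ≅ Γ(B, 𝒪)` through `i₀^*`
  have hsurj : Function.Surjective i₀.appTop := i₀.app_surjective ⊤ (isAffineOpen_top M)
  have hker : Ideal.span (Set.range x) = RingHom.ker i₀.appTop.hom :=
    hgen.trans (Scheme.Hom.ker_apply i₀ Wt)
  let θ₀ : (Γ(M, ⊤) ⧸ Ideal.span (Set.range x)) ≃+* Γ(B, ⊤) :=
    (Ideal.quotEquivOfEq hker).trans (RingHom.quotientKerEquivOfSurjective hsurj)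
  have hθ₀ : ∀ a, θ₀ (Ideal.Quotient.mk _ a) = i₀.appTop a := fun a ↦ by
    change RingHom.quotientKerEquivOfSurjective hsurj (Ideal.quotEquivOfEq hker (Ideal.Quotient.mk _ a)) = _
    rw [Ideal.quotEquivOfEq_mk]
    exact RingHom.quotientKerEquivOfSurjective_apply_mk hsurj a
  have hθ : ∀ a, θ₀.symm (i₀.appTop a) = Ideal.Quotient.mk _ a := fun a ↦ by
    rw [RingEquiv.symm_apply_eq, hθ₀]
  -- the constants: `q^*(i₀^* a)` restricted to `E_{x_j}` is `j^*(β^* a)`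
  have hpull : ∀ s, pull f s = (pullback.snd β i₀).appTop s := fun s ↦ by
    rw [pull_apply, Scheme.Hom.comp_appTop, Scheme.toSpecΓ_appTop, CommRingCat.comp_apply]
    exact congrArg (fun y ↦ (pullback.snd β i₀).appTop y) (Iso.inv_hom_id_apply (Scheme.ΓSpecIso Γ(B, ⊤)) s)
  have hcst : ∀ j a, D.cstr f j (i₀.appTop a) = (pullback.fst β i₀).app (blowupChart β i₀.ker Wt (x j))
      (β.appLE Wt (blowupChart β i₀.ker Wt (x j)) (blowupChart_le_preimage β i₀.ker Wt (x j)) a) := by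
    intro j a
    -- both sides are `(q ≫ i₀)^* a = (j ≫ β)^* a` restricted to `E_{x_j}`
    have h1 : D.cstr f j (i₀.appTop a) = (pullback.snd β i₀ ≫ i₀).appLE ⊤ (D.U j) le_top a := by
      change ((pullback β i₀).presheaf.map (homOfLE le_top).op) (pull f (i₀.appTop a)) = _
      rw [hpull]
      rfl
    have h2 : (pullback.fst β i₀).app (blowupChart β i₀.ker Wt (x j))
        (β.appLE Wt (blowupChart β i₀.ker Wt (x j)) (blowupChart_le_preimage β i₀.ker Wt (x j)) a) =
        (pullback.fst β i₀ ≫ β).appLE ⊤ (D.U j) le_top a := by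
      rw [Scheme.Hom.app_eq_appLE, ← CommRingCat.comp_apply, Scheme.Hom.appLE_comp_appLE]
    rw [h1, h2]
    exact congrArg (fun g ↦ Scheme.Hom.appLE g ⊤ (D.U j) le_top a) pullback.condition.symm
  -- the chart ring maps are bijective
  have hs : ∀ j, Function.Bijective (D.sectionsRingHom f j) := by
    intro j
    obtain ⟨Ψ, hΨC, hΨX⟩ :=
      exists_ringEquiv_sections_chart_mvPolynomial hβ Wt x hgen hqr j (T := T j) (hT j)
    let σ := (ProjectiveSpace.chartAlgEquiv (Γ(B, ⊤) : Type u) j).symm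
    let ρ : MvPolynomial (Fin n) Γ(B, ⊤) ≃+*
        MvPolynomial {l : Fin (n + 1) // l ≠ j} (Γ(M, ⊤) ⧸ Ideal.span (Set.range x)) :=
      (MvPolynomial.renameEquiv (Γ(B, ⊤) : Type u) (finSuccAboveEquiv j)).toRingEquiv.trans
        (MvPolynomial.mapEquiv _ θ₀.symm)
    -- `Ψ ∘ sectionsRingHom ∘ σ = ρ` on generators
    have key : ∀ z, Ψ (D.sectionsRingHom f j (σ z)) = ρ z := by
      intro z
      change (Ψ.toRingHom.comp ((D.sectionsRingHom f j).comp σ.toRingEquiv.toRingHom)) z = ρ.toRingHom z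
      congr 1
      apply MvPolynomial.ringHom_ext
      · intro s
        obtain ⟨a, rfl⟩ := hsurj s
        have e1 : σ (MvPolynomial.C (i₀.appTop a)) = cst (Γ(B, ⊤) : Type u) (MvPolynomial.X j) (i₀.appTop a) :=
          (σ.commutes (i₀.appTop a)).trans (algebraMap_away_eq_cst _ j _)
        have e2 : D.sectionsRingHom f j (cst (Γ(B, ⊤) : Type u) (MvPolynomial.X j) (i₀.appTop a)) =
            (pullback.fst β i₀).app (blowupChart β i₀.ker Wt (x j))
              (β.appLE ⊤ (blowupChart β i₀.ker Wt (x j)) (blowupChart_le_preimage β i₀.ker Wt (x j)) a) := by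
          rw [GeneratingSections.sectionsRingHom_cst]; exact hcst j a
        have e3 : ρ (MvPolynomial.C (i₀.appTop a)) = MvPolynomial.C (Ideal.Quotient.mk _ a) := by
          change MvPolynomial.mapEquiv _ θ₀.symm (MvPolynomial.renameEquiv _ (finSuccAboveEquiv j)
            (MvPolynomial.C (i₀.appTop a))) = _
          rw [MvPolynomial.renameEquiv_apply, MvPolynomial.rename_C, MvPolynomial.mapEquiv_apply,
            MvPolynomial.map_C]
          exact congrArg MvPolynomial.C (hθ a)
        change Ψ (D.sectionsRingHom f j (σ (MvPolynomial.C (i₀.appTop a)))) = ρ (MvPolynomial.C (i₀.appTop a))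
        exact ((congrArg (fun w ↦ Ψ (D.sectionsRingHom f j w)) e1).trans
          ((congrArg Ψ e2).trans (hΨC a))).trans e3.symm
      · intro m
        have e1 : σ (MvPolynomial.X m) = frac (Γ(B, ⊤) : Type u) j (j.succAbove m) :=
          (ProjectiveSpace.chartAlgEquiv_symm_X _ j m).trans (frac_succAbove_eq_chartGen _ j m).symm
        have e2 : D.sectionsRingHom f j (frac (Γ(B, ⊤) : Type u) j (j.succAbove m)) =
            (pullback.fst β i₀).app (blowupChart β i₀.ker Wt (x j)) (T j (j.succAbove m)) :=
          GeneratingSections.sectionsRingHom_frac D f j (j.succAbove m)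
        have e3 : ρ (MvPolynomial.X m) = MvPolynomial.X ⟨j.succAbove m, Fin.succAbove_ne j m⟩ := by
          change MvPolynomial.mapEquiv _ θ₀.symm (MvPolynomial.renameEquiv _ (finSuccAboveEquiv j)
            (MvPolynomial.X m)) = _
          rw [MvPolynomial.renameEquiv_apply, MvPolynomial.rename_X, MvPolynomial.mapEquiv_apply,
            MvPolynomial.map_X, finSuccAboveEquiv_apply]
        change Ψ (D.sectionsRingHom f j (σ (MvPolynomial.X m))) = ρ (MvPolynomial.X m)
        exact ((congrArg (fun w ↦ Ψ (D.sectionsRingHom f j w)) e1).trans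
          ((congrArg Ψ e2).trans (hΨX ⟨j.succAbove m, Fin.succAbove_ne j m⟩))).trans e3.symm
    -- bijectivity from `key`
    constructor
    · intro a b hab
      have ha := key (σ.symm a)
      have hb := key (σ.symm b)
      have ea : σ (σ.symm a) = a := σ.apply_symm_apply a
      have eb : σ (σ.symm b) = b := σ.apply_symm_apply b
      have h : ρ (σ.symm a) = ρ (σ.symm b) :=
        (ha.symm.trans ((congrArg (fun w ↦ Ψ (D.sectionsRingHom f j w)) ea).trans
          ((congrArg Ψ hab).trans ((congrArg (fun w ↦ Ψ (D.sectionsRingHom f j w)) eb).symm)))).trans hb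
      exact σ.symm.injective (ρ.injective h)
    · intro t
      refine ⟨σ (ρ.symm (Ψ t)), Ψ.injective ?_⟩
      exact (key (ρ.symm (Ψ t))).trans (ρ.apply_symm_apply (Ψ t))
  haveI := D.isIso_toProj f hU hs
  exact ⟨asIso (D.toProj f), D.toProj_toSpec f⟩


/-! ## The same isomorphism WITH ITS CHART DATA (appended, v2): `φ⁻¹ D₊(T_j) = E ∩ X'[x_j]`, and on that chart
`φ` is `Spec` of a ring map `(Γ(B)[T]_{T_j})₀ → Γ(E, E ∩ X'[x_j])` PINNED on generators — `T_l/T_j ↦ (β^*x_l/β^*x_j)|_E`,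
constants `i₀^*a ↦ (β^*a)|_E` — so `φ` is determined by the generators `x` and their blow-up ratios. This is the
input a consumer needs to compare the isomorphisms attached to two generator systems of the centre ideal (their
transition is the class of the change-of-generators matrix modulo the ideal, acting linearly on `ℙⁿ_B`), or to read
a member `Σ a_l x_l` of the centre ideal on `E` as the hyperplane `Σ ā_l T_l`. -/

/-- **Hartshorne II Thm. 8.24 (b) / Liu Thm. 8.1.19 (b), affine form, with coordinates.** Hypotheses as in
`exists_iso_pullback_proj_of_isQuasiRegular` (`M` affine, `(ker i₀)(M) = (x₀, …, xₙ)` with `x` quasi-regular,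
`β : X' → M` a blowing up along `ker i₀`), plus a CHOICE of the blow-up chart ratios `T j l ∈ Γ(X', X'[x_j])`,
`β^*x_l = β^*x_j · T j l` (they exist and are unique: `IsBlowup.exists_chartRatio`, `IsBlowup.chartRatio_unique`).
Conclusion: an isomorphism `φ : E = X' ×_M B ≅ ℙⁿ_{Γ(B, 𝒪)}` over `Spec Γ(B, 𝒪)` such that for every `j`:
(i) `φ⁻¹ D₊(T_j) = E_j := pr₁⁻¹ X'[x_j]`; (ii) on `E_j`, `φ` is `E_j → Spec Γ(E, E_j) → Spec (Γ(B)[T]_{T_j})₀ = D₊(T_j)`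
for a ring map `ψ` with `ψ (T_l/T_j) = pr₁^*(T j l)` for all `l` and `ψ (i₀^* a) = pr₁^*(β^* a)` for all
`a ∈ Γ(M, 𝒪)` (these values determine `ψ`: its source is generated over the constants by the `T_l/T_j`). The
isomorphism is the one of `exists_iso_pullback_proj_of_isQuasiRegular` (Hartshorne II Thm. 7.1 for the generating
sections `β^*x_l|_E` of `𝓘·𝒪_{X'}|_E`); only the bookkeeping (i)–(ii) is added (`GeneratingSections.toProj_preimage_basicOpen`,
`ι_toProj`, `chart_eq`, `sectionsRingHom_frac`, `sectionsRingHom_cst`).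
[cite: Hartshorne1977, II Thm. 8.24 (b), Thm. 7.1, Prop. 7.2] [cite: Liu2002, Thm. 8.1.19 (b)] -/
theorem exists_iso_pullback_proj_charts (hβ : IsBlowup β i₀.ker) {n : ℕ}
    (x : Fin (n + 1) → Γ(M, ⊤))
    (hgen : Ideal.span (Set.range x) = i₀.ker.ideal ⟨⊤, isAffineOpen_top M⟩) (hqr : IsQuasiRegular x)
    (T : (j l : Fin (n + 1)) → Γ(X', blowupChart β i₀.ker ⟨⊤, isAffineOpen_top M⟩ (x j)))
    (hT : ∀ j l,
      β.appLE ((⟨⊤, isAffineOpen_top M⟩ : M.affineOpens) : M.Opens)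
          (blowupChart β i₀.ker ⟨⊤, isAffineOpen_top M⟩ (x j))
          (blowupChart_le_preimage β i₀.ker ⟨⊤, isAffineOpen_top M⟩ (x j)) (x l) =
        β.appLE ((⟨⊤, isAffineOpen_top M⟩ : M.affineOpens) : M.Opens)
          (blowupChart β i₀.ker ⟨⊤, isAffineOpen_top M⟩ (x j))
          (blowupChart_le_preimage β i₀.ker ⟨⊤, isAffineOpen_top M⟩ (x j)) (x j) * T j l) :
    ∃ φ : pullback β i₀ ≅ Proj (grading (Fin (n + 1)) Γ(B, ⊤)),
      φ.hom ≫ toSpec (Fin (n + 1)) Γ(B, ⊤) = pullback.snd β i₀ ≫ B.toSpecΓ ∧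
      ∀ j : Fin (n + 1),
        φ.hom ⁻¹ᵁ Proj.basicOpen (grading (Fin (n + 1)) Γ(B, ⊤)) (MvPolynomial.X j) =
            pullback.fst β i₀ ⁻¹ᵁ blowupChart β i₀.ker ⟨⊤, isAffineOpen_top M⟩ (x j) ∧
          ∃ ψ : Away (grading (Fin (n + 1)) Γ(B, ⊤)) (MvPolynomial.X j) →+*
              Γ(pullback β i₀, pullback.fst β i₀ ⁻¹ᵁ blowupChart β i₀.ker ⟨⊤, isAffineOpen_top M⟩ (x j)),
            (pullback.fst β i₀ ⁻¹ᵁ blowupChart β i₀.ker ⟨⊤, isAffineOpen_top M⟩ (x j)).ι ≫ φ.hom =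
                (pullback.fst β i₀ ⁻¹ᵁ blowupChart β i₀.ker ⟨⊤, isAffineOpen_top M⟩ (x j)).toSpecΓ ≫
                  Spec.map (CommRingCat.ofHom ψ) ≫ chartι (Γ(B, ⊤) : Type u) j ∧
              (∀ l, ψ (frac (Γ(B, ⊤) : Type u) j l) =
                (pullback.fst β i₀).app (blowupChart β i₀.ker ⟨⊤, isAffineOpen_top M⟩ (x j)) (T j l)) ∧
              ∀ a : Γ(M, ⊤), ψ (cst (Γ(B, ⊤) : Type u) (MvPolynomial.X j) (i₀.appTop a)) =
                (pullback.fst β i₀).app (blowupChart β i₀.ker ⟨⊤, isAffineOpen_top M⟩ (x j))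
                  (β.appLE ((⟨⊤, isAffineOpen_top M⟩ : M.affineOpens) : M.Opens)
                    (blowupChart β i₀.ker ⟨⊤, isAffineOpen_top M⟩ (x j))
                    (blowupChart_le_preimage β i₀.ker ⟨⊤, isAffineOpen_top M⟩ (x j)) a) := by
  classical
  -- notation
  let Wt : M.affineOpens := ⟨⊤, isAffineOpen_top M⟩
  have hx : ∀ l, x l ∈ i₀.ker.ideal Wt := fun l ↦ hgen ▸ Ideal.subset_span ⟨l, rfl⟩
  -- the ratios `T j l = β^*x_l / β^*x_j` on the charts `X'[M, x_j]` are the hypotheses `T`, `hT`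
  -- the generating-sections data on `E`
  let D : GeneratingSections (Fin (n + 1)) (pullback β i₀) :=
    { U := fun j ↦ pullback.fst β i₀ ⁻¹ᵁ blowupChart β i₀.ker Wt (x j)
      iSup_U := (iSup_preimage_fst_blowupChart hβ Wt x hgen).trans rfl
      ratio := fun j l ↦ (pullback.fst β i₀).app (blowupChart β i₀.ker Wt (x j)) (T j l)
      ratio_self := fun j ↦ by rw [hβ.chartRatio_self Wt (hx j) (hT j j), map_one]
      basicOpen_ratio := fun j l ↦ basicOpen_fst_app_chartRatio hβ Wt (hx j) (hx l) (hT j l)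
      ratio_mul_ratio := fun j l m ↦
        fst_app_chartRatio_mul hβ Wt (hx j) (hx l) (hT j l) (hT l m) (hT j m) }
  let f : pullback β i₀ ⟶ Spec (.of Γ(B, ⊤)) := pullback.snd β i₀ ≫ B.toSpecΓ
  have hU : ∀ j, IsAffineOpen (D.U j) := fun j ↦
    (hβ.isAffineOpen_blowupChart (hx j)).preimage (pullback.fst β i₀)
  -- the centre: `Γ(M, 𝒪) / (x) ≅ Γ(B, 𝒪)` through `i₀^*`
  have hsurj : Function.Surjective i₀.appTop := i₀.app_surjective ⊤ (isAffineOpen_top M)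
  have hker : Ideal.span (Set.range x) = RingHom.ker i₀.appTop.hom :=
    hgen.trans (Scheme.Hom.ker_apply i₀ Wt)
  let θ₀ : (Γ(M, ⊤) ⧸ Ideal.span (Set.range x)) ≃+* Γ(B, ⊤) :=
    (Ideal.quotEquivOfEq hker).trans (RingHom.quotientKerEquivOfSurjective hsurj)
  have hθ₀ : ∀ a, θ₀ (Ideal.Quotient.mk _ a) = i₀.appTop a := fun a ↦ by
    change RingHom.quotientKerEquivOfSurjective hsurj (Ideal.quotEquivOfEq hker (Ideal.Quotient.mk _ a)) = _
    rw [Ideal.quotEquivOfEq_mk]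
    exact RingHom.quotientKerEquivOfSurjective_apply_mk hsurj a
  have hθ : ∀ a, θ₀.symm (i₀.appTop a) = Ideal.Quotient.mk _ a := fun a ↦ by
    rw [RingEquiv.symm_apply_eq, hθ₀]
  -- the constants: `q^*(i₀^* a)` restricted to `E_{x_j}` is `j^*(β^* a)`
  have hpull : ∀ s, pull f s = (pullback.snd β i₀).appTop s := fun s ↦ by
    rw [pull_apply, Scheme.Hom.comp_appTop, Scheme.toSpecΓ_appTop, CommRingCat.comp_apply]
    exact congrArg (fun y ↦ (pullback.snd β i₀).appTop y) (Iso.inv_hom_id_apply (Scheme.ΓSpecIso Γ(B, ⊤)) s)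
  have hcst : ∀ j a, D.cstr f j (i₀.appTop a) = (pullback.fst β i₀).app (blowupChart β i₀.ker Wt (x j))
      (β.appLE Wt (blowupChart β i₀.ker Wt (x j)) (blowupChart_le_preimage β i₀.ker Wt (x j)) a) := by
    intro j a
    -- both sides are `(q ≫ i₀)^* a = (j ≫ β)^* a` restricted to `E_{x_j}`
    have h1 : D.cstr f j (i₀.appTop a) = (pullback.snd β i₀ ≫ i₀).appLE ⊤ (D.U j) le_top a := by
      change ((pullback β i₀).presheaf.map (homOfLE le_top).op) (pull f (i₀.appTop a)) = _
      rw [hpull]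
      rfl
    have h2 : (pullback.fst β i₀).app (blowupChart β i₀.ker Wt (x j))
        (β.appLE Wt (blowupChart β i₀.ker Wt (x j)) (blowupChart_le_preimage β i₀.ker Wt (x j)) a) =
        (pullback.fst β i₀ ≫ β).appLE ⊤ (D.U j) le_top a := by
      rw [Scheme.Hom.app_eq_appLE, ← CommRingCat.comp_apply, Scheme.Hom.appLE_comp_appLE]
    rw [h1, h2]
    exact congrArg (fun g ↦ Scheme.Hom.appLE g ⊤ (D.U j) le_top a) pullback.condition.symm
  -- the chart ring maps are bijective
  have hs : ∀ j, Function.Bijective (D.sectionsRingHom f j) := by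
    intro j
    obtain ⟨Ψ, hΨC, hΨX⟩ :=
      exists_ringEquiv_sections_chart_mvPolynomial hβ Wt x hgen hqr j (T := T j) (hT j)
    let σ := (ProjectiveSpace.chartAlgEquiv (Γ(B, ⊤) : Type u) j).symm
    let ρ : MvPolynomial (Fin n) Γ(B, ⊤) ≃+*
        MvPolynomial {l : Fin (n + 1) // l ≠ j} (Γ(M, ⊤) ⧸ Ideal.span (Set.range x)) :=
      (MvPolynomial.renameEquiv (Γ(B, ⊤) : Type u) (finSuccAboveEquiv j)).toRingEquiv.trans
        (MvPolynomial.mapEquiv _ θ₀.symm)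
    -- `Ψ ∘ sectionsRingHom ∘ σ = ρ` on generators
    have key : ∀ z, Ψ (D.sectionsRingHom f j (σ z)) = ρ z := by
      intro z
      change (Ψ.toRingHom.comp ((D.sectionsRingHom f j).comp σ.toRingEquiv.toRingHom)) z = ρ.toRingHom z
      congr 1
      apply MvPolynomial.ringHom_ext
      · intro s
        obtain ⟨a, rfl⟩ := hsurj s
        have e1 : σ (MvPolynomial.C (i₀.appTop a)) = cst (Γ(B, ⊤) : Type u) (MvPolynomial.X j) (i₀.appTop a) :=
          (σ.commutes (i₀.appTop a)).trans (algebraMap_away_eq_cst _ j _)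
        have e2 : D.sectionsRingHom f j (cst (Γ(B, ⊤) : Type u) (MvPolynomial.X j) (i₀.appTop a)) =
            (pullback.fst β i₀).app (blowupChart β i₀.ker Wt (x j))
              (β.appLE ⊤ (blowupChart β i₀.ker Wt (x j)) (blowupChart_le_preimage β i₀.ker Wt (x j)) a) := by
          rw [GeneratingSections.sectionsRingHom_cst]; exact hcst j a
        have e3 : ρ (MvPolynomial.C (i₀.appTop a)) = MvPolynomial.C (Ideal.Quotient.mk _ a) := by
          change MvPolynomial.mapEquiv _ θ₀.symm (MvPolynomial.renameEquiv _ (finSuccAboveEquiv j)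
            (MvPolynomial.C (i₀.appTop a))) = _
          rw [MvPolynomial.renameEquiv_apply, MvPolynomial.rename_C, MvPolynomial.mapEquiv_apply,
            MvPolynomial.map_C]
          exact congrArg MvPolynomial.C (hθ a)
        change Ψ (D.sectionsRingHom f j (σ (MvPolynomial.C (i₀.appTop a)))) = ρ (MvPolynomial.C (i₀.appTop a))
        exact ((congrArg (fun w ↦ Ψ (D.sectionsRingHom f j w)) e1).trans
          ((congrArg Ψ e2).trans (hΨC a))).trans e3.symm
      · intro m
        have e1 : σ (MvPolynomial.X m) = frac (Γ(B, ⊤) : Type u) j (j.succAbove m) :=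
          (ProjectiveSpace.chartAlgEquiv_symm_X _ j m).trans (frac_succAbove_eq_chartGen _ j m).symm
        have e2 : D.sectionsRingHom f j (frac (Γ(B, ⊤) : Type u) j (j.succAbove m)) =
            (pullback.fst β i₀).app (blowupChart β i₀.ker Wt (x j)) (T j (j.succAbove m)) :=
          GeneratingSections.sectionsRingHom_frac D f j (j.succAbove m)
        have e3 : ρ (MvPolynomial.X m) = MvPolynomial.X ⟨j.succAbove m, Fin.succAbove_ne j m⟩ := by
          change MvPolynomial.mapEquiv _ θ₀.symm (MvPolynomial.renameEquiv _ (finSuccAboveEquiv j)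
            (MvPolynomial.X m)) = _
          rw [MvPolynomial.renameEquiv_apply, MvPolynomial.rename_X, MvPolynomial.mapEquiv_apply,
            MvPolynomial.map_X, finSuccAboveEquiv_apply]
        change Ψ (D.sectionsRingHom f j (σ (MvPolynomial.X m))) = ρ (MvPolynomial.X m)
        exact ((congrArg (fun w ↦ Ψ (D.sectionsRingHom f j w)) e1).trans
          ((congrArg Ψ e2).trans (hΨX ⟨j.succAbove m, Fin.succAbove_ne j m⟩))).trans e3.symm
    -- bijectivity from `key`
    constructor
    · intro a b hab
      have ha := key (σ.symm a)
      have hb := key (σ.symm b)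
      have ea : σ (σ.symm a) = a := σ.apply_symm_apply a
      have eb : σ (σ.symm b) = b := σ.apply_symm_apply b
      have h : ρ (σ.symm a) = ρ (σ.symm b) :=
        (ha.symm.trans ((congrArg (fun w ↦ Ψ (D.sectionsRingHom f j w)) ea).trans
          ((congrArg Ψ hab).trans ((congrArg (fun w ↦ Ψ (D.sectionsRingHom f j w)) eb).symm)))).trans hb
      exact σ.symm.injective (ρ.injective h)
    · intro t
      refine ⟨σ (ρ.symm (Ψ t)), Ψ.injective ?_⟩
      exact (key (ρ.symm (Ψ t))).trans (ρ.apply_symm_apply (Ψ t))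
  haveI := D.isIso_toProj f hU hs
  refine ⟨asIso (D.toProj f), D.toProj_toSpec f, fun j ↦ ⟨D.toProj_preimage_basicOpen f j,
    D.sectionsRingHom f j, ?_, fun l ↦ D.sectionsRingHom_frac f j l, fun a ↦ ?_⟩⟩
  · change (D.U j).ι ≫ D.toProj f = (D.U j).toSpecΓ ≫ _
    rw [D.ι_toProj f j, D.chart_eq f j]
  · rw [D.sectionsRingHom_cst]
    exact hcst j a

end Literature.AlgebraicGeometry.Resolution

end
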